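import Literature.NumberTheory.ComplexMultiplication.FaltingsTateOfPrimitiveCM
import Summits.HodgeConjecture.HodgeConjecture.Theorems.HCCMUnconditionalShimuraThm18_6Holds
import HarnessLib

/-!
# T5 (N2) — [Fal83 §5 Kor. 1] for powers of a CM abelian variety of PRIMITIVE type, every dimension, UNCONDITIONALLY

Cell hodgecm-mathlib, fan A, binder hLiu418 (item stmt-HodgeConjecture-24832), sub-skeleton
`Cruxes/HLiu418/Lines/faltings_isogeny.lean` (row VI-1 = the floor binder
`hFal : ∀ {K} [Field K] (A B : AbelianVariety K) ℓ [Fact ℓ.Prime], faltings_tate_bijective A B ℓ`; T5 ledger row (N2),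
A-plan1 g7).  The Literature heads of `Literature.NumberTheory.ComplexMultiplication.FaltingsTateOfPrimitiveCM` prove,
granted the named fact `shimura1998_thm18_6` ([Shimura 1998, Thm. 18.6]), that for a structure `(A₀, ι₀)` of a
PRIMITIVE CM type `(K, Φ)` over a number field `k ⊆ ℂ` — ANY dimension `g = [K:ℚ]/2` — (i) for every prime `ℓ` some
`σ₀ ∈ Γ_k` acts on `T_ℓ A₀` as `T_ℓ(ι₀ π)` with `ℚ(π) = K` ([Shimura 1998, §13.2 Thm. 2, proof]), and hence (ii) the Tate
map `ℤ_ℓ ⊗ Hom_k(A, B) → Hom_{Γ_k}(T_ℓ A, T_ℓ B)` is bijective for every `A ~ A₀ᵃ`, `B ~ A₀ᵇ`; that fact is a THEOREM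
of the tree Summits-side (`Theorems.shimura1998_thm18_6_holds`, row II-1), so here the VI-1 TEXT ITSELF is decided with
NO hypothesis on this family — extending ★ `HLiu418FaltingsTateOfCMEllipticPowers` (g = 1) to every primitive type.
Witness rung («distance ledger»); no floor change, books 0.

HC_CM is proved only modulo the printed citations of the floor until rung 0 closes; this file moves no floor binder.
-/

-- mandated namespace `Summit.HodgeConjecture.HodgeConjecture.Theorems` trips `linter.dupNamespace` (single-problem
-- summit); off as in `HCCMUnconditionalShimuraThm18_6Holds.lean`.
set_option linter.dupNamespace false

open CategoryTheory CategoryTheory.Limits NumberField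
open scoped NumberField IntermediateField

namespace Summit.HodgeConjecture.HodgeConjecture.Theorems

open Literature.AlgebraicGeometry.Motives
open Literature.NumberTheory.ComplexMultiplication

/-- **ONE scalar Frobenius generating `K`, for a structure of PRIMITIVE CM type, unconditionally**: for `(A₀, ι₀)`
of CM type `(K, Φ)` over a number field `k ⊆ ℂ` with `Φ` primitive (`IsPrimitive (ℂ ≃+* ℂ) Φ φ₀`, [Shimura 1998,
§8.2 Prop. 26]) and every prime `ℓ`, some `σ₀ ∈ Γ_k` and `π ∈ 𝓞_K` satisfy `ρ_ℓ(σ₀) = T_ℓ(ι₀ π)` and `ℚ(π) = K`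
— the Literature head fed with the tree's theorem `shimura1998_thm18_6_holds`.
[cite: Shimura1998, §13.2 Theorem 2 (proof), §13.1 Theorem 1 (ii), §8.2 Proposition 26 and §18.6 Theorem 18.6] -/
theorem exists_tateRep_eq_tateModuleMap_and_adjoin_eq_top_of_primitive_CM
    {k : Type} [Field k] [NumberField k] [Algebra k ℂ] {K : Type} [Field K] [NumberField K] [IsCMField K]
    (Φ : CMType K) (A₀ : AbelianVariety k) (ι₀ : 𝓞 K →+* End A₀) (hA : IsCMTypeRealisationOver Φ A₀ ι₀)
    {φ₀ : K →+* ℂ} (hprim : IsPrimitive (ℂ ≃+* ℂ) Φ.1 φ₀) (ℓ : ℕ) [Fact ℓ.Prime] :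
    ∃ (σ₀ : Field.absoluteGaloisGroup k) (π : 𝓞 K),
      A₀.tateRep ℓ σ₀ = AbelianVariety.tateModuleMap ℓ (ι₀ π : A₀ ⟶ A₀) ∧ ℚ⟮(π : K)⟯ = ⊤ :=
  exists_tateRep_eq_tateModuleMap_and_adjoin_eq_top_of_isPrimitive shimura1998_thm18_6_holds Φ A₀ ι₀ hA hprim ℓ

/-- **[Faltings 1983, §5 Kor. 1] on the isogeny class of powers of a structure of PRIMITIVE CM type, every dimension,
unconditionally**: for `(A₀, ι₀)` of CM type `(K, Φ)` over a number field `k ⊆ ℂ` with `Φ` primitive, all `a b`,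
every `A` `k`-isogenous to `⨁_{Fin a} A₀`, every `B` `k`-isogenous to `⨁_{Fin b} A₀` and every prime `ℓ`,
`faltings_tate_bijective A B ℓ`. [cite: Faltings1983Endlichkeit, §5 Korollar 1]
[cite: Shimura1998, §13.2 Theorem 2 and §18.6 Theorem 18.6] -/
theorem faltings_tate_bijective_of_isIsogenous_pow_of_primitive_CM
    {k : Type} [Field k] [Algebra k ℂ] {K : Type} [Field K] [NumberField K] [IsCMField K]
    (Φ : CMType K) (A₀ : AbelianVariety k) (ι₀ : 𝓞 K →+* End A₀) (hA : IsCMTypeRealisationOver Φ A₀ ι₀)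
    {φ₀ : K →+* ℂ} (hprim : IsPrimitive (ℂ ≃+* ℂ) Φ.1 φ₀) {a b : ℕ} {A B : AbelianVariety k}
    (hAiso : AbelianVariety.IsIsogenous (⨁ fun _ : Fin a => A₀) A)
    (hBiso : AbelianVariety.IsIsogenous (⨁ fun _ : Fin b => A₀) B) (ℓ : ℕ) [Fact ℓ.Prime] :
    faltings_tate_bijective A B ℓ := by
  intro hk
  exact faltings_tate_bijective_of_isIsogenous_pow_of_isPrimitive_of_thm18_6 shimura1998_thm18_6_holds Φ A₀ ι₀ hA
    hprim hAiso hBiso ℓ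

/-- **[Faltings 1983, §5 Kor. 1] on the isogeny class of powers of a SIMPLE CM abelian variety, every dimension,
unconditionally** (`A₀ ⊗ ℂ` simple ⟺ `Φ` primitive, [Shimura 1998, §8.2 Prop. 26]).
[cite: Faltings1983Endlichkeit, §5 Korollar 1] [cite: Shimura1998, §8.2 Proposition 26, §13.2 Theorem 2 and §18.6 Theorem 18.6] -/
theorem faltings_tate_bijective_of_isIsogenous_pow_of_simple_CM
    {k : Type} [Field k] [Algebra k ℂ] {K : Type} [Field K] [NumberField K] [IsCMField K]
    (Φ : CMType K) (A₀ : AbelianVariety k) (ι₀ : 𝓞 K →+* End A₀) (hA : IsCMTypeRealisationOver Φ A₀ ι₀)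
    (hS : (A₀.baseChange ℂ).IsSimple) {a b : ℕ} {A B : AbelianVariety k}
    (hAiso : AbelianVariety.IsIsogenous (⨁ fun _ : Fin a => A₀) A)
    (hBiso : AbelianVariety.IsIsogenous (⨁ fun _ : Fin b => A₀) B) (ℓ : ℕ) [Fact ℓ.Prime] :
    faltings_tate_bijective A B ℓ := by
  intro hk
  exact faltings_tate_bijective_of_isIsogenous_pow_of_isSimple_of_thm18_6 shimura1998_thm18_6_holds Φ A₀ ι₀ hA hS
    hAiso hBiso ℓ

/-- **Tate's hypothesis along `ℓ`-power towers for a structure of PRIMITIVE CM type, unconditionally** (the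
`faltings_isogeny` line's junction `tateHypEllPowerTower`, decided on this family).
[cite: Tate1966Endomorphisms, §2 pp. 136–137] [cite: Shimura1998, §13.2 Theorem 2 and §18.6 Theorem 18.6] -/
theorem tateHypEllPowerTower_of_primitive_CM
    {k : Type} [Field k] [Algebra k ℂ] {K : Type} [Field K] [NumberField K] [IsCMField K]
    (Φ : CMType K) (A₀ : AbelianVariety k) (ι₀ : 𝓞 K →+* End A₀) (hA : IsCMTypeRealisationOver Φ A₀ ι₀)
    {φ₀ : K →+* ℂ} (hprim : IsPrimitive (ℂ ≃+* ℂ) Φ.1 φ₀) (ℓ : ℕ) [Fact ℓ.Prime] :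
    A₀.tateHypEllPowerTower ℓ := by
  intro hk
  exact tateHypEllPowerTower_of_isPrimitive_of_thm18_6 shimura1998_thm18_6_holds Φ A₀ ι₀ hA hprim ℓ

end Summit.HodgeConjecture.HodgeConjecture.Theorems
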